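import Literature.MathematicalPhysics.QuantumLattice.HubbardTTPrimeDiagHopTransport
import HarnessLib

/-!
# JOINT `(t', U)` cap transport at `T = 0`: the anchor window of a ground state anywhere in a
# rectangle, and BOX ⇒ WORD on the `(t'-box) × (U-box)` cell from ONE anchor certificate

Family `hubbard` (topic `MathematicalPhysics/QuantumLattice`). Companion of `HubbardTTPrimeDiagHopTransport`
(§3–§4 there: the `t'`-only cap transport and BOX ⇒ WORD) and of `HubbardTTPrimeDoccTransportThermal`
(§4 there: the joint cell at `T > 0`). Written for stage S2 of the Hubbard material-oracle programme, whose
delivered boxes are RECTANGLES `[s₁,s₂] × [U₁,U₂]` in `(t'/t, U/t)` at fixed `t ≡ 1` and density `n`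
(`S2Seam`): the energy WINDOW on such a rectangle is `HubbardTTPrimeBoxTransport` /
`energyDensityTT'_rect_…` (box seats); this file supplies the missing CAP-CLASS WORD transport on the
rectangle — every torus-limit ground state at any `(s, U)` of the cell sits, for the ANCHOR Hamiltonian
`H(t,s₀,U₀)`, in an explicitly inflated energy window, so a property certified at the anchor for the cap
class holds on the whole cell.

* §1 `IsTorusLimitOf.meanEnergy_anchor₂_le_of_groundStates` / `…_mem_Icc_of_groundStates`: for torus-limit
  ground states `ω₀` at the anchor `(s₀, U₀)` and `ω` at `(s, U)` (`U₀, U ≥ 0`, `0 ≤ n < 2`),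
  `e(t,s₀,U₀,n) ≤ e_{Φ(t,s₀,U₀)}(ω) ≤ e(t,s₀,U₀,n) + (s − s₀)(K₂(ω₀) − K₂(ω)) + (U − U₀)(D(ω₀) − D(ω))`
  (affinity of `e_Φ(ω)` in both couplings, `e_{Φ(t,s,U)}(ω) = e(t,s,U,n)`, joint supergradient
  inequality at the anchor; the excess is `≥ 0` by joint concavity — Koma–Tasaki).
* §2 `…meanEnergy_anchor₂_mem_Icc_kinematic`: `≤ e(t,s₀,U₀,n) + (32/π²)|s − s₀| + (n/2 − max(0,n−1))|U − U₀|`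
  (kinematic `K₂` and docc ranges of both states).
* §3 `…meanEnergy_anchor₂_le_of_rectWords`: with RECTANGLE-UNIFORM ground-state windows
  `K₂ ∈ [B_K, A_K]`, `D ∈ [B_D, A_D]` (valid for every torus-limit ground state at every point of the
  rectangle — e.g. the kinematic ones, or corner words moved along the edges by the single-axis rows),
  `e_{Φ(t,s₀,U₀)}(ω) ≤ u₀ + |s − s₀|(A_K − B_K) + |U − U₀|(A_D − B_D)` for an anchor in the rectangle.
* §4 the CELL THEOREMS `forall_groundState_tPrime_U_box_of_forall_cap_kinematic` and
  `forall_groundState_tPrime_U_box_of_forall_cap`: a property `P` certified at the anchor for the cap class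
  (torus limits of unit `rectN n L`-particle vectors with `e_{Φ(t,s₀,U₀)}(ω) ≤ u`) holds for EVERY
  torus-limit ground state at EVERY `(s, U) ∈ [s₁,s₂] × [U₁,U₂]` (`U₁ ≥ 0`) once
  `u ≥ u₀ + (32/π²)·max(s₂−s₀, s₀−s₁) + (n/2 − max(0,n−1))·max(U₂−U₀, U₀−U₁)` (kinematic) or
  `u ≥ u₀ + max(s₂−s₀, s₀−s₁)(A_K − B_K) + max(U₂−U₀, U₀−U₁)(A_D − B_D)` (rectangle words).

Everything is PROVED; no definition, no named fact, no number. HONEST SCOPE: words proved only for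
ground states AT the anchor (eom rows of `H(s₀,U₀)`) do not transport this way (a ground state at
`(s,U) ≠ (s₀,U₀)` is not stationary for the anchor Hamiltonian) — those go through the cell kernels
(`HubbardTTPrimeWindowCertificateConvexComb/CrossCuts`, `…AnchorTransport`); size of the loss at
`n = 7/8`: `3.24|Δt'| + 0.44|ΔU|` per unit `t` kinematically.

## Mathlib / tree search

REUSED: `meanEnergy_hubbardTTPrime_affine`, `IsTorusLimitOf.energyDensityTT'_le_affine`,
`IsTorusLimitOf.meanEnergy_hubbardTTPrime_eq_energyDensityTT'`, `….energyDensityTT'_le_meanEnergy_hubbardTTPrime`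
(`HubbardTTPrimeMeanEnergySupergradient`), `IsTorusLimitOf.abs_meanEnergy_diagHop_le`, `….docc_nonneg`,
`….docc_le_half_density`, `….density_sub_one_le_docc` (`HubbardOneBodyKinematicRows`),
`exists_isTorusLimitOf_sectorGroundState_TT'` (`HubbardNNNHoppingTorusLimitCorrelator`), and the
`t'`-only templates of `HubbardTTPrimeDiagHopTransport` §3–§4.
`lean search 'anchor₂|tPrime_U_box|rect.*forall_cap' --decl`: only the `T > 0` joint theorem of
`HubbardTTPrimeDoccTransportThermal`; the `T = 0` joint cap-class transport was not in the tree (the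
rectangle ENERGY window is `energyDensityTT'_rect_mem_Icc_of_anchor_endpointWords`, a different object).

## References

* T. Koma, H. Tasaki, J. Stat. Phys. 76 (1994) 745, §1 (joint concavity of the ground-state energy in
  the couplings; `∂E/∂U = ⟨D⟩`). [cite: KomaTasaki1994, §1]
* D. Ruelle, *Statistical Mechanics: Rigorous Results* (1969), §3.4. [cite: Ruelle1969, §3.4]
* E. H. Lieb, M. Loss, Duke Math. J. 71 (1993) 337, §8 Thm. 8.2. [cite: LiebLoss1993, §8, Theorem 8.2]
-/

noncomputable section

namespace Literature.MathematicalPhysics.QuantumLattice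

open Matrix Finset HubbardWave0 Literature.Probability.LatticeModels ThermodynamicLimit
open _root_.Filter
open scoped _root_.Topology ComplexOrder BigOperators

namespace InfVolFermionState

/-! ### §1 The joint cap-transport inequality (two ground states) -/

/-- **Joint cap transport, two ground states.** Let `ω₀` be a torus-limit ground state at the ANCHOR
`(t, s₀, U₀)` and `ω` one at `(t, s, U)`, both of density `n` (`U₀, U ≥ 0`, `0 ≤ n < 2`). Then
`e_{Φ(t,s₀,U₀)}(ω) ≤ e(t,s₀,U₀,n) + (s − s₀)(K₂(ω₀) − K₂(ω)) + (U − U₀)(D(ω₀) − D(ω))`.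
[cite: KomaTasaki1994, §1] -/
theorem IsTorusLimitOf.meanEnergy_anchor₂_le_of_groundStates (t s₀ s : ℝ) {U₀ U : ℝ} (hU₀ : 0 ≤ U₀)
    (hU : 0 ≤ U) {n : ℝ} (hn0 : 0 ≤ n) (hn2 : n < 2)
    {ω₀ ω : InfVolFermionState 2} {ψ₀ ψ : ∀ L, Fock (Orb (FermionTorus 2 L))} {Ls₀ Ls : ℕ → ℕ}
    (h₀ : ω₀.IsTorusLimitOf ψ₀ Ls₀) (hLs₀ : Tendsto Ls₀ atTop atTop)
    (hψ₀ : ∀ j, IsGroundStateInSector (hubbardTorusTT' (Ls₀ j) t s₀ U₀) (rectN n (Ls₀ j)) 0 (ψ₀ (Ls₀ j)))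
    (h1₀ : ∀ j, star (ψ₀ (Ls₀ j)) ⬝ᵥ ψ₀ (Ls₀ j) = 1)
    (h : ω.IsTorusLimitOf ψ Ls) (hLs : Tendsto Ls atTop atTop)
    (hψ : ∀ j, IsGroundStateInSector (hubbardTorusTT' (Ls j) t s U) (rectN n (Ls j)) 0 (ψ (Ls j)))
    (h1 : ∀ j, star (ψ (Ls j)) ⬝ᵥ ψ (Ls j) = 1) :
    ω.meanEnergy (hubbardTTPrimeFermionInteraction t s₀ U₀) 1 ≤
      energyDensityTT' t s₀ U₀ n +
        (s - s₀) * (ω₀.meanEnergy (hubbardTTPrimeFermionInteraction 0 1 0) 1 -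
          ω.meanEnergy (hubbardTTPrimeFermionInteraction 0 1 0) 1) +
        (U - U₀) * (ω₀.meanEnergy (hubbardTTPrimeFermionInteraction 0 0 1) 1 -
          ω.meanEnergy (hubbardTTPrimeFermionInteraction 0 0 1) 1) := by
  have haff := ω.meanEnergy_hubbardTTPrime_affine t s U s₀ U₀
  have hgs := h.meanEnergy_hubbardTTPrime_eq_energyDensityTT' t s hU hn0 hn2 hLs hψ h1
  have htan := h₀.energyDensityTT'_le_affine t s₀ hU₀ hn0 hn2 hLs₀ hψ₀ h1₀ s hU
  rw [haff, hgs]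
  have k1 : (U₀ - U) * ω.meanEnergy (hubbardTTPrimeFermionInteraction 0 0 1) 1 =
      -((U - U₀) * ω.meanEnergy (hubbardTTPrimeFermionInteraction 0 0 1) 1) := by ring
  have k2 : (s₀ - s) * ω.meanEnergy (hubbardTTPrimeFermionInteraction 0 1 0) 1 =
      -((s - s₀) * ω.meanEnergy (hubbardTTPrimeFermionInteraction 0 1 0) 1) := by ring
  rw [k1, k2, mul_sub, mul_sub]
  linarith

/-- **The anchor window of a ground state anywhere in the `(t', U)` plane (two ground states)**: the
lower end is the variational principle `e(t,s₀,U₀,n) ≤ e_{Φ(t,s₀,U₀)}(ω)`. [cite: Ruelle1969, §3.4] [cite: KomaTasaki1994, §1] -/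
theorem IsTorusLimitOf.meanEnergy_anchor₂_mem_Icc_of_groundStates (t s₀ s : ℝ) {U₀ U : ℝ} (hU₀ : 0 ≤ U₀)
    (hU : 0 ≤ U) {n : ℝ} (hn0 : 0 ≤ n) (hn2 : n < 2)
    {ω₀ ω : InfVolFermionState 2} {ψ₀ ψ : ∀ L, Fock (Orb (FermionTorus 2 L))} {Ls₀ Ls : ℕ → ℕ}
    (h₀ : ω₀.IsTorusLimitOf ψ₀ Ls₀) (hLs₀ : Tendsto Ls₀ atTop atTop)
    (hψ₀ : ∀ j, IsGroundStateInSector (hubbardTorusTT' (Ls₀ j) t s₀ U₀) (rectN n (Ls₀ j)) 0 (ψ₀ (Ls₀ j)))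
    (h1₀ : ∀ j, star (ψ₀ (Ls₀ j)) ⬝ᵥ ψ₀ (Ls₀ j) = 1)
    (h : ω.IsTorusLimitOf ψ Ls) (hLs : Tendsto Ls atTop atTop)
    (hψ : ∀ j, IsGroundStateInSector (hubbardTorusTT' (Ls j) t s U) (rectN n (Ls j)) 0 (ψ (Ls j)))
    (h1 : ∀ j, star (ψ (Ls j)) ⬝ᵥ ψ (Ls j) = 1) :
    ω.meanEnergy (hubbardTTPrimeFermionInteraction t s₀ U₀) 1 ∈
      Set.Icc (energyDensityTT' t s₀ U₀ n)
        (energyDensityTT' t s₀ U₀ n +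
          (s - s₀) * (ω₀.meanEnergy (hubbardTTPrimeFermionInteraction 0 1 0) 1 -
            ω.meanEnergy (hubbardTTPrimeFermionInteraction 0 1 0) 1) +
          (U - U₀) * (ω₀.meanEnergy (hubbardTTPrimeFermionInteraction 0 0 1) 1 -
            ω.meanEnergy (hubbardTTPrimeFermionInteraction 0 0 1) 1)) := by
  have hN : ∀ j, IsNParticle (rectN n (Ls j)) (ψ (Ls j)) := fun j =>
    ((mem_szSector_iff _ _ _).1 (hψ j).1).1
  exact ⟨h.energyDensityTT'_le_meanEnergy_hubbardTTPrime t s₀ hU₀ hn0 hn2 hLs hN h1,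
    IsTorusLimitOf.meanEnergy_anchor₂_le_of_groundStates t s₀ s hU₀ hU hn0 hn2 h₀ hLs₀ hψ₀ h1₀ h hLs hψ h1⟩

/-! ### §2 Kinematic form -/

/-- **Joint anchor window, kinematic form** (no words): every torus-limit ground state `ω` at `(t, s, U)`
(`U ≥ 0`) satisfies, for every anchor `(s₀, U₀)` with `U₀ ≥ 0`,
`e(t,s₀,U₀,n) ≤ e_{Φ(t,s₀,U₀)}(ω) ≤ e(t,s₀,U₀,n) + (32/π²)|s − s₀| + (n/2 − max(0,n−1))·|U − U₀|`
(`|K₂| ≤ 16/π²` and `D ∈ [max(0,n−1), n/2]` for both ground states; a torus-limit ground state at the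
anchor exists). [cite: LiebLoss1993, §8, Theorem 8.2] [cite: KomaTasaki1994, §1] -/
theorem IsTorusLimitOf.meanEnergy_anchor₂_mem_Icc_kinematic (t s₀ s : ℝ) {U₀ U : ℝ} (hU₀ : 0 ≤ U₀)
    (hU : 0 ≤ U) {n : ℝ} (hn0 : 0 ≤ n) (hn2 : n < 2)
    {ω : InfVolFermionState 2} {ψ : ∀ L, Fock (Orb (FermionTorus 2 L))} {Ls : ℕ → ℕ}
    (h : ω.IsTorusLimitOf ψ Ls) (hLs : Tendsto Ls atTop atTop)
    (hψ : ∀ j, IsGroundStateInSector (hubbardTorusTT' (Ls j) t s U) (rectN n (Ls j)) 0 (ψ (Ls j)))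
    (h1 : ∀ j, star (ψ (Ls j)) ⬝ᵥ ψ (Ls j) = 1) :
    ω.meanEnergy (hubbardTTPrimeFermionInteraction t s₀ U₀) 1 ∈
      Set.Icc (energyDensityTT' t s₀ U₀ n)
        (energyDensityTT' t s₀ U₀ n + 32 / Real.pi ^ 2 * |s - s₀| + (n / 2 - max 0 (n - 1)) * |U - U₀|) := by
  obtain ⟨ψ₀, φ₀, ω₀, hφ₀, hψ₀, h1₀, h₀, -, -, -⟩ :=
    exists_isTorusLimitOf_sectorGroundState_TT' t s₀ U₀ hn0 hn2.le tendsto_id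
  have hL₀ : Tendsto (id ∘ φ₀) atTop atTop := tendsto_id.comp hφ₀.tendsto_atTop
  have hwin := IsTorusLimitOf.meanEnergy_anchor₂_mem_Icc_of_groundStates t s₀ s hU₀ hU hn0 hn2 h₀ hL₀
    (fun j => hψ₀ _) (fun j => h1₀ _) h hLs hψ h1
  refine ⟨hwin.1, hwin.2.trans ?_⟩
  have hN : ∀ j, IsNParticle (rectN n (Ls j)) (ψ (Ls j)) := fun j =>
    ((mem_szSector_iff _ _ _).1 (hψ j).1).1
  have hN₀ : ∀ j, IsNParticle (rectN n ((id ∘ φ₀) j)) (ψ₀ ((id ∘ φ₀) j)) := fun j =>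
    ((mem_szSector_iff _ _ _).1 (hψ₀ _).1).1
  have hK := h.abs_meanEnergy_diagHop_le hn0 hn2 hLs hN h1
  have hK₀ := h₀.abs_meanEnergy_diagHop_le hn0 hn2 hL₀ hN₀ (fun j => h1₀ _)
  have hDlo : max 0 (n - 1) ≤ ω.meanEnergy (hubbardTTPrimeFermionInteraction 0 0 1) 1 :=
    max_le (h.docc_nonneg hLs) (h.density_sub_one_le_docc hn0 hLs hN h1)
  have hDhi := h.docc_le_half_density hn0 hLs hN h1
  have hD₀lo : max 0 (n - 1) ≤ ω₀.meanEnergy (hubbardTTPrimeFermionInteraction 0 0 1) 1 :=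
    max_le (h₀.docc_nonneg hL₀) (h₀.density_sub_one_le_docc hn0 hL₀ hN₀ (fun j => h1₀ _))
  have hD₀hi := h₀.docc_le_half_density hn0 hL₀ hN₀ (fun j => h1₀ _)
  rw [abs_le] at hK hK₀
  have h3 : (s - s₀) * (ω₀.meanEnergy (hubbardTTPrimeFermionInteraction 0 1 0) 1 -
      ω.meanEnergy (hubbardTTPrimeFermionInteraction 0 1 0) 1) ≤ 32 / Real.pi ^ 2 * |s - s₀| := by
    have hdiff : |ω₀.meanEnergy (hubbardTTPrimeFermionInteraction 0 1 0) 1 -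
        ω.meanEnergy (hubbardTTPrimeFermionInteraction 0 1 0) 1| ≤ 16 / Real.pi ^ 2 + 16 / Real.pi ^ 2 := by
      rw [abs_le]; constructor <;> linarith [hK.1, hK.2, hK₀.1, hK₀.2]
    calc _ ≤ |(s - s₀) * (ω₀.meanEnergy (hubbardTTPrimeFermionInteraction 0 1 0) 1 -
          ω.meanEnergy (hubbardTTPrimeFermionInteraction 0 1 0) 1)| := le_abs_self _
      _ = |s - s₀| * |ω₀.meanEnergy (hubbardTTPrimeFermionInteraction 0 1 0) 1 -
          ω.meanEnergy (hubbardTTPrimeFermionInteraction 0 1 0) 1| := abs_mul _ _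
      _ ≤ |s - s₀| * (16 / Real.pi ^ 2 + 16 / Real.pi ^ 2) := mul_le_mul_of_nonneg_left hdiff (abs_nonneg _)
      _ = 32 / Real.pi ^ 2 * |s - s₀| := by ring
  have h4 : (U - U₀) * (ω₀.meanEnergy (hubbardTTPrimeFermionInteraction 0 0 1) 1 -
      ω.meanEnergy (hubbardTTPrimeFermionInteraction 0 0 1) 1) ≤ (n / 2 - max 0 (n - 1)) * |U - U₀| := by
    have hdiff : |ω₀.meanEnergy (hubbardTTPrimeFermionInteraction 0 0 1) 1 -
        ω.meanEnergy (hubbardTTPrimeFermionInteraction 0 0 1) 1| ≤ n / 2 - max 0 (n - 1) := by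
      rw [abs_le]; constructor <;> linarith
    calc _ ≤ |(U - U₀) * (ω₀.meanEnergy (hubbardTTPrimeFermionInteraction 0 0 1) 1 -
          ω.meanEnergy (hubbardTTPrimeFermionInteraction 0 0 1) 1)| := le_abs_self _
      _ = |U - U₀| * |ω₀.meanEnergy (hubbardTTPrimeFermionInteraction 0 0 1) 1 -
          ω.meanEnergy (hubbardTTPrimeFermionInteraction 0 0 1) 1| := abs_mul _ _
      _ ≤ |U - U₀| * (n / 2 - max 0 (n - 1)) := mul_le_mul_of_nonneg_left hdiff (abs_nonneg _)
      _ = (n / 2 - max 0 (n - 1)) * |U - U₀| := mul_comm _ _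
  linarith

/-! ### §3 Word form: rectangle-uniform ground-state windows -/

/-- **Joint anchor cap priced by RECTANGLE-UNIFORM words.** If every torus-limit ground state at every
`(s', U') ∈ [s₁,s₂] × [U₁,U₂]` has `K₂ ∈ [B_K, A_K]` and `D ∈ [B_D, A_D]`, the anchor `(s₀, U₀)` and the
point `(s, U)` lie in the rectangle (`U₁ ≥ 0`), and `e(t,s₀,U₀,n) ≤ u₀`, then every torus-limit ground
state `ω` at `(t, s, U)` has `e_{Φ(t,s₀,U₀)}(ω) ≤ u₀ + |s − s₀|(A_K − B_K) + |U − U₀|(A_D − B_D)`.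
[cite: KomaTasaki1994, §1] -/
theorem IsTorusLimitOf.meanEnergy_anchor₂_le_of_rectWords (t : ℝ) {s₁ s₂ U₁ U₂ s₀ U₀ s U : ℝ}
    (hU₁ : 0 ≤ U₁) (hs₀ : s₀ ∈ Set.Icc s₁ s₂) (hU₀ : U₀ ∈ Set.Icc U₁ U₂) (hs : s ∈ Set.Icc s₁ s₂)
    (hUm : U ∈ Set.Icc U₁ U₂) {n : ℝ} (hn0 : 0 ≤ n) (hn2 : n < 2) {u₀ AK BK AD BD : ℝ}
    (hu₀ : energyDensityTT' t s₀ U₀ n ≤ u₀)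
    (hK : ∀ (s' U' : ℝ), s' ∈ Set.Icc s₁ s₂ → U' ∈ Set.Icc U₁ U₂ →
      ∀ (ω' : InfVolFermionState 2) (Ls' : ℕ → ℕ) (ψ' : ∀ L, Fock (Orb (FermionTorus 2 L))),
      Tendsto Ls' atTop atTop →
      (∀ j, IsGroundStateInSector (hubbardTorusTT' (Ls' j) t s' U') (rectN n (Ls' j)) 0 (ψ' (Ls' j))) →
      (∀ j, star (ψ' (Ls' j)) ⬝ᵥ ψ' (Ls' j) = 1) → ω'.IsTorusLimitOf ψ' Ls' →
      ω'.meanEnergy (hubbardTTPrimeFermionInteraction 0 1 0) 1 ∈ Set.Icc BK AK)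
    (hD : ∀ (s' U' : ℝ), s' ∈ Set.Icc s₁ s₂ → U' ∈ Set.Icc U₁ U₂ →
      ∀ (ω' : InfVolFermionState 2) (Ls' : ℕ → ℕ) (ψ' : ∀ L, Fock (Orb (FermionTorus 2 L))),
      Tendsto Ls' atTop atTop →
      (∀ j, IsGroundStateInSector (hubbardTorusTT' (Ls' j) t s' U') (rectN n (Ls' j)) 0 (ψ' (Ls' j))) →
      (∀ j, star (ψ' (Ls' j)) ⬝ᵥ ψ' (Ls' j) = 1) → ω'.IsTorusLimitOf ψ' Ls' →
      ω'.meanEnergy (hubbardTTPrimeFermionInteraction 0 0 1) 1 ∈ Set.Icc BD AD)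
    {ω : InfVolFermionState 2} {ψ : ∀ L, Fock (Orb (FermionTorus 2 L))} {Ls : ℕ → ℕ}
    (h : ω.IsTorusLimitOf ψ Ls) (hLs : Tendsto Ls atTop atTop)
    (hψ : ∀ j, IsGroundStateInSector (hubbardTorusTT' (Ls j) t s U) (rectN n (Ls j)) 0 (ψ (Ls j)))
    (h1 : ∀ j, star (ψ (Ls j)) ⬝ᵥ ψ (Ls j) = 1) :
    ω.meanEnergy (hubbardTTPrimeFermionInteraction t s₀ U₀) 1 ≤
      u₀ + |s - s₀| * (AK - BK) + |U - U₀| * (AD - BD) := by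
  obtain ⟨ψ₀, φ₀, ω₀, hφ₀, hψ₀, h1₀, h₀, -, -, -⟩ :=
    exists_isTorusLimitOf_sectorGroundState_TT' t s₀ U₀ hn0 hn2.le tendsto_id
  have hL₀ : Tendsto (id ∘ φ₀) atTop atTop := tendsto_id.comp hφ₀.tendsto_atTop
  have hU₀' : 0 ≤ U₀ := hU₁.trans hU₀.1
  have hU' : 0 ≤ U := hU₁.trans hUm.1
  have hgs := IsTorusLimitOf.meanEnergy_anchor₂_le_of_groundStates t s₀ s hU₀' hU' hn0 hn2 h₀ hL₀
    (fun j => hψ₀ _) (fun j => h1₀ _) h hLs hψ h1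
  have hKω := hK s U hs hUm ω Ls ψ hLs hψ h1 h
  have hKω₀ := hK s₀ U₀ hs₀ hU₀ ω₀ (id ∘ φ₀) ψ₀ hL₀ (fun j => hψ₀ _) (fun j => h1₀ _) h₀
  have hDω := hD s U hs hUm ω Ls ψ hLs hψ h1 h
  have hDω₀ := hD s₀ U₀ hs₀ hU₀ ω₀ (id ∘ φ₀) ψ₀ hL₀ (fun j => hψ₀ _) (fun j => h1₀ _) h₀
  have h3 : (s - s₀) * (ω₀.meanEnergy (hubbardTTPrimeFermionInteraction 0 1 0) 1 -
      ω.meanEnergy (hubbardTTPrimeFermionInteraction 0 1 0) 1) ≤ |s - s₀| * (AK - BK) := by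
    have hdiff : |ω₀.meanEnergy (hubbardTTPrimeFermionInteraction 0 1 0) 1 -
        ω.meanEnergy (hubbardTTPrimeFermionInteraction 0 1 0) 1| ≤ AK - BK := by
      rw [abs_le]; constructor <;> linarith [hKω.1, hKω.2, hKω₀.1, hKω₀.2]
    calc _ ≤ |(s - s₀) * (ω₀.meanEnergy (hubbardTTPrimeFermionInteraction 0 1 0) 1 -
          ω.meanEnergy (hubbardTTPrimeFermionInteraction 0 1 0) 1)| := le_abs_self _
      _ = |s - s₀| * |ω₀.meanEnergy (hubbardTTPrimeFermionInteraction 0 1 0) 1 -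
          ω.meanEnergy (hubbardTTPrimeFermionInteraction 0 1 0) 1| := abs_mul _ _
      _ ≤ |s - s₀| * (AK - BK) := mul_le_mul_of_nonneg_left hdiff (abs_nonneg _)
  have h4 : (U - U₀) * (ω₀.meanEnergy (hubbardTTPrimeFermionInteraction 0 0 1) 1 -
      ω.meanEnergy (hubbardTTPrimeFermionInteraction 0 0 1) 1) ≤ |U - U₀| * (AD - BD) := by
    have hdiff : |ω₀.meanEnergy (hubbardTTPrimeFermionInteraction 0 0 1) 1 -
        ω.meanEnergy (hubbardTTPrimeFermionInteraction 0 0 1) 1| ≤ AD - BD := by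
      rw [abs_le]; constructor <;> linarith [hDω.1, hDω.2, hDω₀.1, hDω₀.2]
    calc _ ≤ |(U - U₀) * (ω₀.meanEnergy (hubbardTTPrimeFermionInteraction 0 0 1) 1 -
          ω.meanEnergy (hubbardTTPrimeFermionInteraction 0 0 1) 1)| := le_abs_self _
      _ = |U - U₀| * |ω₀.meanEnergy (hubbardTTPrimeFermionInteraction 0 0 1) 1 -
          ω.meanEnergy (hubbardTTPrimeFermionInteraction 0 0 1) 1| := abs_mul _ _
      _ ≤ |U - U₀| * (AD - BD) := mul_le_mul_of_nonneg_left hdiff (abs_nonneg _)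
  linarith

/-! ### §4 BOX ⇒ WORD on the `(t', U)` cell -/

/-- Distance to an anchor inside/outside a box is at most the larger of the two end distances. [folklore] -/
private theorem abs_sub_le_max_of_mem_Icc {a b x₀ x : ℝ} (hx : x ∈ Set.Icc a b) :
    |x - x₀| ≤ max (b - x₀) (x₀ - a) := by
  rcases le_total x₀ x with h0x | hx0
  · rw [abs_of_nonneg (sub_nonneg.2 h0x)]
    exact (sub_le_sub_right hx.2 _).trans (le_max_left _ _)
  · rw [abs_of_nonpos (sub_nonpos.2 hx0), neg_sub]
    exact (sub_le_sub_left hx.1 _).trans (le_max_right _ _)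

/-- **BOX ⇒ WORD on the `(t', U)` cell, kinematic.** Fix `t`, a density `0 ≤ n < 2`, a rectangle
`[s₁,s₂] × [U₁,U₂]` (`U₁ ≥ 0`), an anchor `(s₀, U₀)` (`U₀ ≥ 0`, anywhere) with a certified cap
`e(t,s₀,U₀,n) ≤ u₀`, and a property `P` certified for the CAP CLASS at the anchor: every torus limit
(along some `Ls → ∞`) of unit `rectN n L`-particle vectors with `e_{Φ(t,s₀,U₀)}(ω) ≤ u`. If
`u ≥ u₀ + (32/π²)·max(s₂−s₀, s₀−s₁) + (n/2 − max(0,n−1))·max(U₂−U₀, U₀−U₁)`, then `P ω` for every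
torus-limit ground state at every `(s, U)` of the rectangle. [cite: KomaTasaki1994, §1] [cite: LiebLoss1993, §8, Theorem 8.2] -/
theorem forall_groundState_tPrime_U_box_of_forall_cap_kinematic (t : ℝ) {s₁ s₂ U₁ U₂ : ℝ} (s₀ : ℝ)
    {U₀ : ℝ} (hU₀ : 0 ≤ U₀) (hU₁ : 0 ≤ U₁) {n : ℝ} (hn0 : 0 ≤ n) (hn2 : n < 2) {u₀ u : ℝ}
    (hu₀ : energyDensityTT' t s₀ U₀ n ≤ u₀)
    (hu : u₀ + 32 / Real.pi ^ 2 * max (s₂ - s₀) (s₀ - s₁) +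
      (n / 2 - max 0 (n - 1)) * max (U₂ - U₀) (U₀ - U₁) ≤ u)
    {P : InfVolFermionState 2 → Prop}
    (hP : ∀ (ω : InfVolFermionState 2) (Ls : ℕ → ℕ) (ψ : ∀ L, Fock (Orb (FermionTorus 2 L))),
      Tendsto Ls atTop atTop → (∀ j, IsNParticle (rectN n (Ls j)) (ψ (Ls j))) →
      (∀ j, star (ψ (Ls j)) ⬝ᵥ ψ (Ls j) = 1) → ω.IsTorusLimitOf ψ Ls →
      ω.meanEnergy (hubbardTTPrimeFermionInteraction t s₀ U₀) 1 ≤ u → P ω)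
    {s U : ℝ} (hs : s ∈ Set.Icc s₁ s₂) (hUm : U ∈ Set.Icc U₁ U₂)
    {ω : InfVolFermionState 2} {ψ : ∀ L, Fock (Orb (FermionTorus 2 L))} {Ls : ℕ → ℕ}
    (h : ω.IsTorusLimitOf ψ Ls) (hLs : Tendsto Ls atTop atTop)
    (hψ : ∀ j, IsGroundStateInSector (hubbardTorusTT' (Ls j) t s U) (rectN n (Ls j)) 0 (ψ (Ls j)))
    (h1 : ∀ j, star (ψ (Ls j)) ⬝ᵥ ψ (Ls j) = 1) : P ω := by
  have hN : ∀ j, IsNParticle (rectN n (Ls j)) (ψ (Ls j)) := fun j =>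
    ((mem_szSector_iff _ _ _).1 (hψ j).1).1
  refine hP ω Ls ψ hLs hN h1 h ?_
  have hcap := (h.meanEnergy_anchor₂_mem_Icc_kinematic t s₀ s hU₀ (hU₁.trans hUm.1) hn0 hn2 hLs hψ h1).2
  have hds := abs_sub_le_max_of_mem_Icc (x₀ := s₀) hs
  have hdU := abs_sub_le_max_of_mem_Icc (x₀ := U₀) hUm
  have hπ : 0 ≤ 32 / Real.pi ^ 2 := by positivity
  have hw : 0 ≤ n / 2 - max 0 (n - 1) := by
    rw [sub_nonneg, max_le_iff]; constructor <;> linarith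
  nlinarith [mul_le_mul_of_nonneg_left hds hπ, mul_le_mul_of_nonneg_left hdU hw]

/-- **BOX ⇒ WORD on the `(t', U)` cell, rectangle words.** As the kinematic form, with the inflation
`u ≥ u₀ + max(s₂−s₀, s₀−s₁)·(A_K − B_K) + max(U₂−U₀, U₀−U₁)·(A_D − B_D)` from rectangle-uniform
ground-state windows `K₂ ∈ [B_K, A_K]`, `D ∈ [B_D, A_D]` and an anchor INSIDE the rectangle.
[cite: KomaTasaki1994, §1] -/
theorem forall_groundState_tPrime_U_box_of_forall_cap (t : ℝ) {s₁ s₂ U₁ U₂ s₀ U₀ : ℝ}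
    (hU₁ : 0 ≤ U₁) (hs₀ : s₀ ∈ Set.Icc s₁ s₂) (hU₀ : U₀ ∈ Set.Icc U₁ U₂) {n : ℝ} (hn0 : 0 ≤ n)
    (hn2 : n < 2) {u₀ u AK BK AD BD : ℝ} (hu₀ : energyDensityTT' t s₀ U₀ n ≤ u₀)
    (hK : ∀ (s' U' : ℝ), s' ∈ Set.Icc s₁ s₂ → U' ∈ Set.Icc U₁ U₂ →
      ∀ (ω' : InfVolFermionState 2) (Ls' : ℕ → ℕ) (ψ' : ∀ L, Fock (Orb (FermionTorus 2 L))),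
      Tendsto Ls' atTop atTop →
      (∀ j, IsGroundStateInSector (hubbardTorusTT' (Ls' j) t s' U') (rectN n (Ls' j)) 0 (ψ' (Ls' j))) →
      (∀ j, star (ψ' (Ls' j)) ⬝ᵥ ψ' (Ls' j) = 1) → ω'.IsTorusLimitOf ψ' Ls' →
      ω'.meanEnergy (hubbardTTPrimeFermionInteraction 0 1 0) 1 ∈ Set.Icc BK AK)
    (hD : ∀ (s' U' : ℝ), s' ∈ Set.Icc s₁ s₂ → U' ∈ Set.Icc U₁ U₂ →
      ∀ (ω' : InfVolFermionState 2) (Ls' : ℕ → ℕ) (ψ' : ∀ L, Fock (Orb (FermionTorus 2 L))),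
      Tendsto Ls' atTop atTop →
      (∀ j, IsGroundStateInSector (hubbardTorusTT' (Ls' j) t s' U') (rectN n (Ls' j)) 0 (ψ' (Ls' j))) →
      (∀ j, star (ψ' (Ls' j)) ⬝ᵥ ψ' (Ls' j) = 1) → ω'.IsTorusLimitOf ψ' Ls' →
      ω'.meanEnergy (hubbardTTPrimeFermionInteraction 0 0 1) 1 ∈ Set.Icc BD AD)
    (hu : u₀ + max (s₂ - s₀) (s₀ - s₁) * (AK - BK) + max (U₂ - U₀) (U₀ - U₁) * (AD - BD) ≤ u)
    {P : InfVolFermionState 2 → Prop}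
    (hP : ∀ (ω : InfVolFermionState 2) (Ls : ℕ → ℕ) (ψ : ∀ L, Fock (Orb (FermionTorus 2 L))),
      Tendsto Ls atTop atTop → (∀ j, IsNParticle (rectN n (Ls j)) (ψ (Ls j))) →
      (∀ j, star (ψ (Ls j)) ⬝ᵥ ψ (Ls j) = 1) → ω.IsTorusLimitOf ψ Ls →
      ω.meanEnergy (hubbardTTPrimeFermionInteraction t s₀ U₀) 1 ≤ u → P ω)
    {s U : ℝ} (hs : s ∈ Set.Icc s₁ s₂) (hUm : U ∈ Set.Icc U₁ U₂)
    {ω : InfVolFermionState 2} {ψ : ∀ L, Fock (Orb (FermionTorus 2 L))} {Ls : ℕ → ℕ}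
    (h : ω.IsTorusLimitOf ψ Ls) (hLs : Tendsto Ls atTop atTop)
    (hψ : ∀ j, IsGroundStateInSector (hubbardTorusTT' (Ls j) t s U) (rectN n (Ls j)) 0 (ψ (Ls j)))
    (h1 : ∀ j, star (ψ (Ls j)) ⬝ᵥ ψ (Ls j) = 1) : P ω := by
  have hN : ∀ j, IsNParticle (rectN n (Ls j)) (ψ (Ls j)) := fun j =>
    ((mem_szSector_iff _ _ _).1 (hψ j).1).1
  refine hP ω Ls ψ hLs hN h1 h ?_
  have hcap := h.meanEnergy_anchor₂_le_of_rectWords t hU₁ hs₀ hU₀ hs hUm hn0 hn2 hu₀ hK hD hLs hψ h1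
  have hKω := hK s U hs hUm ω Ls ψ hLs hψ h1 h
  have hDω := hD s U hs hUm ω Ls ψ hLs hψ h1 h
  have hAK : 0 ≤ AK - BK := by linarith [hKω.1, hKω.2]
  have hAD : 0 ≤ AD - BD := by linarith [hDω.1, hDω.2]
  have hds := abs_sub_le_max_of_mem_Icc (x₀ := s₀) hs
  have hdU := abs_sub_le_max_of_mem_Icc (x₀ := U₀) hUm
  nlinarith [mul_le_mul_of_nonneg_right hds hAK, mul_le_mul_of_nonneg_right hdU hAD]

end InfVolFermionState

end Literature.MathematicalPhysics.QuantumLattice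

end
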